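import Literature.AnabelianGeometry.EtaleTheta.Discharge.Sec2Cor219iiiDiscrepancySquare
import Literature.AnabelianGeometry.EtaleTheta.Discharge.Sec2Cor218AdmissibleAutDeltaStable
import Literature.AnabelianGeometry.EtaleTheta.Discharge.Sec2Cor219iiiHeartAtValue
import Literature.AnabelianGeometry.EtaleTheta.Discharge.Sec2Cor219iiiHgenParityAtModelChi
import HarnessLib

/-!
# [EtTh] Cor. 2.19 (iii) at the Tate model: the even-level heart for every Δ-stable admissible automorphism
# (row «COR219III-M1b-EVEN (β)», file 2 of 2 — the heart via abc-iut-L1-t6's socket, then `modelχq p i j`; proof-only)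

S. Mochizuki, *The Étale Theta Function and its Frobenioid-theoretic Manifestations* [EtTh], Publ. RIMS **45** (2009), §2
Cor. 2.19 (iii) p. 64 [cite: MochizukiEtTh2009, Cor 2.19 (iii) p.64].  Cell `abc-iut`, K-L6 row «COR219III-M1b-EVEN (β)»
(abc-iut-L6-lead gen 7, §F v1.19cu/cz/dd), seat abc-iut-w5-d187 (gen 8).  PROOF-ONLY: no definition, no instance, no notation, no
new named fact; consumed BY NAME — file 1 (`Sec2Cor219iiiDiscrepancySquare`), abc-iut-L1-t6's socket `heart_of_uniqueness_at'`
(`Sec2Cor219iiiHeartAtValue`, p488904) and model lemmas `toTheta_commutatorElement_eq_cThetaχq` / `exists_zpow_red_cThetaχq_pow_eq`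
(`Sec2Cor219iiiHgenParityAtModelChi`, p487040), abc-iut-L2-t5's `ThetaSetting.modelχq_isEtThOrigin`, abc-iut-L2-d1, abc-iut-L2-t6 and abc-iut-w5-d171
model vocabulary (`Huuχq`-free: EVERY `X̲̲`-choice `C`).

WHAT IS SHOWN.
* §1 (generic) `heart_of_isSquare_of_aug_apply_eq_one` — the level-`M` Δ_P-heart `∃ m, red_M ∘ F = red_M ∘ conjRoot(ã^m) f on Δ_P`
  for every admissible `γ` keeping `b̂` geometric, from file 1's square theorem and the socket (given `hsq`: squares of `μ_M` are
  commutator values at `(ã, b̂²)`), at EVERY level `M`.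
* §2 (Tate model `modelχq p i j`, `j` even; EVERY `E`, EVERY `X̲̲`-choice, every tower, every level):
  `toTheta_comm_eq_cThetaχq_zpow_neg_two` (`⟨θ⁅ã⁻¹, b⁆⟩ = (c^{ι(1)^l})^{-2}` for `deg ã = l`, `ŷ(b) = ι(1)²` — abc-iut-L1-t6's internal
  computation, isolated); **`forall_sq_eq_red_comm_modelχq`** (EVERY square of `μ_M` is `red_M θ⁅(ã^m)⁻¹, b⁆` — the even-level
  replacement of abc-iut-f-142's `hgen`, at every level); **`exists_zpow_red_comm_eq_discrepancy_modelχq`** (the RESIDUE/socket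
  form «`∃ m, red_M θ⁅(ã^m)⁻¹, b̂²⁆ = red_M(F b̂²)·red_M(f b̂²)⁻¹`» for EVERY admissible `γ`, the (PH)-input of abc-iut-L1-t6's (3m) and
  of abc-iut-f-142's `forall_exists_exponent_value_of_residue`).
* §3 (Tate model, NO Δ-stability hypothesis): with file 3 (`Sec2Cor218AdmissibleAutDeltaStable`: every admissible `γ` with clause
  (4) is Δ-stable at the model, from slimness + elasticity of `G_K`), **`isSquare_transport_discrepancy_modelχq`** and
  **`heart_modelχq`** — (β) and the even-level heart for EVERY admissible `γ` of `cor219_iii_of_hearts` (clauses (4), (5) as there).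
RESIDUAL: beyond the `cor219_iii_of_hearts` binders and abc-iut-L1-t6's (D1*) `huniq`, NONE at the model (§3).  The `m` produced
is level-wise (`m_M`, determined mod `M` by the global element `F(b)·f(b)⁻¹ ∈ l·Δ_Θ`), not one tempered conjugator.
HONEST LABEL: statements about the SEMI-SYNTHETIC stage-2 model of OUR typed §1 interface (binder-discharge evidence), NOT about the
tempered fundamental group of a curve; nothing of [EtTh] (refereed) is asserted or denied for a curve; no side is taken on
[IUTchIII] Cor. 3.12; typed ≠ proved; instantiated ≠ endorsed; nothing here asserts abc proved or refuted.
-/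

noncomputable section

namespace Literature.AnabelianGeometry.EtaleTheta

open Literature.AnabelianGeometry.SemiGraphs

namespace ThetaSetting.EtaleThetaData.DoubleUnderline

variable {p : ℕ} [Fact p.Prime] {D : ThetaSetting p} {E : D.EtaleThetaData} {l : ℕ}
  (C : E.DoubleUnderline l) {Es : Set ℕ+} (τ : D.CyclotomeTower l Es)

/-! ## §1 Generic: the heart for a Δ-stable admissible `γ` via abc-iut-L1-t6's socket -/

/-- **The level-`M` Δ_P-HEART for a Δ-stable admissible `γ`** — abc-iut-L1-t6's socket `heart_of_uniqueness_at'` (p488904)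
fed with (β): under the socket's standing inputs (`hFmul`, clause (c) `hFc`, (D1*) uniqueness `huniq`) and `hsq` (squares are
commutator values at `(ã, b)`), for every admissible `γ` keeping `b̂` geometric there is `m` with
`red_M ∘ F = red_M ∘ conjRoot(ã^m) f` on `Δ_P` — at EVERY level, even or odd. [cite: MochizukiEtTh2009, Cor 2.19 (iii) p.64] -/
theorem heart_of_isSquare_of_aug_apply_eq_one (hC : D.Compat) (hS : D.Sec2Hyps)
    (h15 : Prop15iii E hC) (hO : D.IsEtThOrigin)
    (γ : (C.thetaEnvTower τ hC hS).PiX ≃ₜ* (C.thetaEnvTower τ hC hS).PiX)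
    (hγ : (C.thetaEnvTower τ hC hS).PiYdd.map γ.toMulEquiv.toMonoidHom = (C.thetaEnvTower τ hC hS).PiYdd)
    (hL : (C.thetaEnvTower τ hC hS).lDeltaTheta.map γ.toMulEquiv.toMonoidHom = (C.thetaEnvTower τ hC hS).lDeltaTheta)
    (γΛ : D.lDeltaTheta l ≃* D.lDeltaTheta l)
    (hγΛ : ∀ (g : (C.thetaEnvTower τ hC hS).lDeltaTheta) (hg : γ g ∈ (C.thetaEnvTower τ hC hS).lDeltaTheta),
      C.toLDelta ⟨γ g, hg⟩ = γΛ (C.toLDelta g))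
    (M : Es) (γμ : (C.thetaEnvTower τ hC hS).mu M ≃* (C.thetaEnvTower τ hC hS).mu M)
    (hγμ : ∀ (g : (C.thetaEnvTower τ hC hS).lDeltaTheta) (hg : γ g ∈ (C.thetaEnvTower τ hC hS).lDeltaTheta),
      (C.thetaEnvTower τ hC hS).thetaMod M ⟨γ g, hg⟩ = γμ ((C.thetaEnvTower τ hC hS).thetaMod M g))
    {f : contCocycles D.toTheta D.DeltaTheta C.GtpYdduu} (hf : f ∈ C.rootCocycles hC)
    (F : C.GtpYdduu → D.lDeltaTheta l)
    (hF : ∀ g : (C.thetaEnvTower τ hC hS).PiYdd,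
      F (C.inclYdduu g) = γΛ.symm ⟨(f.1 (C.inclYdduu ⟨γ g, C.apply_mem_PiYdd τ hC hS γ hγ g⟩) : D.GtpTheta), hf.1 _⟩)
    (hFmul : ∀ g h : C.GtpYdduu, (F (g * h) : D.GtpTheta) =
      (F g : D.GtpTheta) * (D.toTheta (g : D.PiTemp) * (F h : D.GtpTheta) * (D.toTheta (g : D.PiTemp))⁻¹))
    (hFc : (C.thetaEnvTower τ hC hS).pullbackCocycle M γ hγ γμ (C.modN (τ.mod M) f hf.1) =
      fun g => (τ.mod M).red (F (C.inclYdduu g)))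
    (a : C.Huu) (ha : D.aug.toMonoidHom (a : D.PiTemp) = 1)
    (bh : C.Huu) (hbh : D.aug.toMonoidHom (bh : D.PiTemp) = 1)
    (hb2 : bh ^ 2 ∈ (C.thetaEnvTower τ hC hS).PiYdd)
    (hγbh : D.aug.toMonoidHom ((γ bh : C.Huu) : D.PiTemp) = 1)
    (huniq : ∀ φ ψ : (C.thetaEnvTower τ hC hS).PiYdd → MuN p M, IsLocallyConstant φ → IsLocallyConstant ψ →
      (∀ g h : (C.thetaEnvTower τ hC hS).PiYdd, D.aug.toMonoidHom ((g : C.Huu) : D.PiTemp) = 1 →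
        D.aug.toMonoidHom ((h : C.Huu) : D.PiTemp) = 1 → φ (g * h) = φ g * φ h) →
      (∀ g h : (C.thetaEnvTower τ hC hS).PiYdd, D.aug.toMonoidHom ((g : C.Huu) : D.PiTemp) = 1 →
        D.aug.toMonoidHom ((h : C.Huu) : D.PiTemp) = 1 → ψ (g * h) = ψ g * ψ h) →
      (∀ g : (C.thetaEnvTower τ hC hS).PiYdd, D.aug.toMonoidHom ((g : C.Huu) : D.PiTemp) = 1 →
        D.toTheta ((g : C.Huu) : D.PiTemp) ∈ D.DeltaTheta → φ g = ψ g) →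
      φ ⟨bh ^ 2, hb2⟩ = ψ ⟨bh ^ 2, hb2⟩ →
      ∀ g : (C.thetaEnvTower τ hC hS).PiYdd, D.aug.toMonoidHom ((g : C.Huu) : D.PiTemp) = 1 → φ g = ψ g)
    (hsq : ∀ s : MuN p M, ∃ (m : ℤ) (hm : D.toTheta ((((a ^ m : C.Huu) : D.PiTemp))⁻¹ *
        (((⟨bh ^ 2, hb2⟩ : (C.thetaEnvTower τ hC hS).PiYdd) : C.Huu) : D.PiTemp) *
        ((a ^ m : C.Huu) : D.PiTemp) * ((((⟨bh ^ 2, hb2⟩ : (C.thetaEnvTower τ hC hS).PiYdd) : C.Huu) : D.PiTemp))⁻¹) ∈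
        D.lDeltaTheta l), (τ.mod M).red ⟨_, hm⟩ = s ^ 2) :
    ∃ m : ℤ, ∀ g : (C.thetaEnvTower τ hC hS).PiYdd, D.aug.toMonoidHom ((g : C.Huu) : D.PiTemp) = 1 →
      (τ.mod M).red (F (C.inclYdduu g)) =
        (τ.mod M).red ⟨(C.conjRoot hC (a ^ m) f.1 (C.inclYdduu g) : D.GtpTheta),
          (D.lDeltaTheta_normal l).conj_mem _ (hf.1 _) _⟩ := by
  have hb : D.aug.toMonoidHom ((((⟨bh ^ 2, hb2⟩ : (C.thetaEnvTower τ hC hS).PiYdd) : C.Huu)) : D.PiTemp) = 1 := by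
    change D.aug.toMonoidHom (((bh ^ 2 : C.Huu)) : D.PiTemp) = 1
    rw [Subgroup.coe_pow, map_pow, hbh, one_pow]
  obtain ⟨m, hm, hred⟩ := C.exists_zpow_red_comm_eq_discrepancy_of_aug_apply_eq_one τ hC hS h15 hO γ hγ hL γΛ hγΛ M γμ
    hγμ hf F hF bh hbh hb2 hγbh a hsq
  exact ⟨m, C.heart_of_uniqueness_at' τ hC hS h15 γ hγ hL γΛ hγΛ M γμ hf F hF hFmul hFc a ha ⟨bh ^ 2, hb2⟩ hb huniq m hm
    hred⟩

end ThetaSetting.EtaleThetaData.DoubleUnderline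

/-! ## §2 At the Tate model `modelχq p i j` (`j` even): every `E`, every `X̲̲`-choice, every tower, every level -/

namespace SettingModel

open _root_.Function
open scoped commutatorElement
variable (p : ℕ) [Fact p.Prime] (i j : ℤ) (hj : Even j)

/-- **`⟨θ⁅ã⁻¹, b⁆⟩ = (c^{ι(1)^l})^{-2}` at the Tate model** (every `X̲̲`-choice; `ã` geometric of degree `l`, `b` geometric with
`ŷ(b) = ι(1)²`) — the computation inside abc-iut-L1-t6's `forall_exists_zpow_red_comm_of_odd` (p487040 §3), isolated via his
`toTheta_commutatorElement_eq_cThetaχq`. [cite: MochizukiEtTh2009, Cor 2.19 (iii) p.64] -/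
theorem toTheta_comm_eq_cThetaχq_zpow_neg_two {E : (ThetaSetting.modelχq p i j hj).EtaleThetaData} {l : ℕ}
    (C : E.DoubleUnderline l) (a : C.Huu)
    (ha : (ThetaSetting.modelχq p i j hj).aug.toMonoidHom (a : (ThetaSetting.modelχq p i j hj).PiTemp) = 1)
    (hdeg : Multiplicative.toAdd (gfpSnd (a : PiTpχq p i j).left) = (l : ℤ))
    (b : ↥((ThetaSetting.modelχq p i j hj).GtpYdd.subgroupOf C.Huu))
    (hb : (ThetaSetting.modelχq p i j hj).aug.toMonoidHom ((b : C.Huu) : (ThetaSetting.modelχq p i j hj).PiTemp) = 1)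
    (hyb : yCoordχq p i j ((b : C.Huu) : PiTpχq p i j) = (iotaZ (Multiplicative.ofAdd 1)) ^ 2)
    (h₁ : (ThetaSetting.modelχq p i j hj).toTheta
      (((a : (ThetaSetting.modelχq p i j hj).PiTemp))⁻¹ * ((b : C.Huu) : (ThetaSetting.modelχq p i j hj).PiTemp) *
        (a : (ThetaSetting.modelχq p i j hj).PiTemp) * (((b : C.Huu) : (ThetaSetting.modelχq p i j hj).PiTemp))⁻¹) ∈
      (ThetaSetting.modelχq p i j hj).lDeltaTheta l) :
    (⟨_, h₁⟩ : (ThetaSetting.modelχq p i j hj).lDeltaTheta l) =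
      (⟨cThetaχq p i j ((iotaZ (Multiplicative.ofAdd 1)) ^ l),
        ⟨cThetaχq p i j (iotaZ (Multiplicative.ofAdd 1)), cThetaχq_mem_ker p i j _, by rw [map_pow]⟩⟩) ^ (-2 : ℤ) := by
  -- verbatim the internal steps of abc-iut-L1-t6's `forall_exists_zpow_red_comm_of_odd` (p487040), cited
  have ha' : (a : PiTpχq p i j).right = 1 := ha
  have hb' : ((b : C.Huu) : PiTpχq p i j).right = 1 := hb
  have hbY' : ((b : C.Huu) : PiTpχq p i j) ∈ (ThetaSetting.modelχq p i j hj).GtpYdd := b.2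
  have hbY : ((b : C.Huu) : PiTpχq p i j) ∈ YNχq p i j 2 := (GtpYdd_modelχq p i j hj).le hbY'
  obtain ⟨⟨hbZ, -⟩, -⟩ := (GfpTwistData₀.mem_YN _).mp hbY
  have hZ : gfpSnd ((b : C.Huu) : PiTpχq p i j).left = 1 := hbZ
  have hcomm : (ThetaSetting.modelχq p i j hj).toTheta
      (((a : (ThetaSetting.modelχq p i j hj).PiTemp))⁻¹ * ((b : C.Huu) : (ThetaSetting.modelχq p i j hj).PiTemp) *
        (a : (ThetaSetting.modelχq p i j hj).PiTemp) * (((b : C.Huu) : (ThetaSetting.modelχq p i j hj).PiTemp))⁻¹) =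
      CurveTheta.toTheta (curveχq p i j) ⁅((a : PiTpχq p i j))⁻¹, ((b : C.Huu) : PiTpχq p i j)⁆ := by
    rw [commutatorElement_def, inv_inv]
  have hA := toTheta_commutatorElement_eq_cThetaχq p i j ((a : PiTpχq p i j))⁻¹ ((b : C.Huu) : PiTpχq p i j)
    (by rw [SemidirectProduct.inv_right, ha', inv_one]) hb' hZ
  have hinvleft : ((a : PiTpχq p i j)⁻¹).left = ((a : PiTpχq p i j).left)⁻¹ := by
    rw [SemidirectProduct.inv_left, ha', inv_one, map_one, MulAut.one_apply]
  apply Subtype.ext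
  show (ThetaSetting.modelχq p i j hj).toTheta _ = (cThetaχq p i j ((iotaZ (Multiplicative.ofAdd 1)) ^ l)) ^ (-2 : ℤ)
  rw [hcomm, hA, hinvleft, map_inv, toAdd_inv, hdeg, hyb, ← map_zpow]
  congr 1
  rw [← zpow_natCast, ← zpow_natCast, ← zpow_mul, ← zpow_mul]
  congr 1
  ring

/-- **At the Tate model every SQUARE of `μ_M` is a commutator value `red_M θ⁅(ã^m)⁻¹, b⁆`** (every level, every `X̲̲`-choice;
`deg ã = l`, `ŷ(b) = ι(1)²`) — abc-iut-L1-t6's generator `red_M(c^{ι(1)^l})` (p487040) + `toTheta_comm_eq_cThetaχq_zpow_neg_two`; the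
hypothesis `hsq` of §1, the even-level replacement of f-142's `hgen`/`honto`. [cite: MochizukiEtTh2009, Cor 2.19 (iii) p.64] -/
theorem forall_sq_eq_red_comm_modelχq {E : (ThetaSetting.modelχq p i j hj).EtaleThetaData} {l : ℕ}
    (C : E.DoubleUnderline l) {Es : Set ℕ+} (τ : (ThetaSetting.modelχq p i j hj).CyclotomeTower l Es)
    (hC : (ThetaSetting.modelχq p i j hj).Compat) (hS : (ThetaSetting.modelχq p i j hj).Sec2Hyps) (M : Es) (a : C.Huu)
    (ha : (ThetaSetting.modelχq p i j hj).aug.toMonoidHom (a : (ThetaSetting.modelχq p i j hj).PiTemp) = 1)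
    (hdeg : Multiplicative.toAdd (gfpSnd (a : PiTpχq p i j).left) = (l : ℤ))
    (b : (C.thetaEnvTower τ hC hS).PiYdd)
    (hb : (ThetaSetting.modelχq p i j hj).aug.toMonoidHom ((b : C.Huu) : (ThetaSetting.modelχq p i j hj).PiTemp) = 1)
    (hyb : yCoordχq p i j ((b : C.Huu) : PiTpχq p i j) = (iotaZ (Multiplicative.ofAdd 1)) ^ 2) :
    ∀ s : MuN p M, ∃ (m : ℤ) (hm : (ThetaSetting.modelχq p i j hj).toTheta
        ((((a ^ m : C.Huu) : (ThetaSetting.modelχq p i j hj).PiTemp))⁻¹ *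
          ((b : C.Huu) : (ThetaSetting.modelχq p i j hj).PiTemp) *
          ((a ^ m : C.Huu) : (ThetaSetting.modelχq p i j hj).PiTemp) *
          (((b : C.Huu) : (ThetaSetting.modelχq p i j hj).PiTemp))⁻¹) ∈ (ThetaSetting.modelχq p i j hj).lDeltaTheta l),
      (τ.mod M).red ⟨_, hm⟩ = s ^ 2 := by
  -- `θ⁅ã⁻¹, b⁆ ∈ l·Δ_Θ`: a commutator of geometric elements of `Π^tp_X̲̲` dies in `(Π^tp_X)^ell` and lies in `θ(Π^tp_X̲̲)`
  have haInv : (ThetaSetting.modelχq p i j hj).aug.toMonoidHom ((a : (ThetaSetting.modelχq p i j hj).PiTemp))⁻¹ = 1 := by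
    rw [map_inv, ha, inv_one]
  have hΔ : (ThetaSetting.modelχq p i j hj).toTheta
      (((a : (ThetaSetting.modelχq p i j hj).PiTemp))⁻¹ * ((b : C.Huu) : (ThetaSetting.modelχq p i j hj).PiTemp) *
        (a : (ThetaSetting.modelχq p i j hj).PiTemp) * (((b : C.Huu) : (ThetaSetting.modelχq p i j hj).PiTemp))⁻¹) ∈
      (ThetaSetting.modelχq p i j hj).DeltaTheta := by
    simpa only [inv_inv] using (ThetaSetting.modelχq p i j hj).toTheta_comm_mem_DeltaTheta haInv hb
  have hHuu : (ThetaSetting.modelχq p i j hj).toTheta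
      (((a : (ThetaSetting.modelχq p i j hj).PiTemp))⁻¹ * ((b : C.Huu) : (ThetaSetting.modelχq p i j hj).PiTemp) *
        (a : (ThetaSetting.modelχq p i j hj).PiTemp) * (((b : C.Huu) : (ThetaSetting.modelχq p i j hj).PiTemp))⁻¹) ∈
      C.Huu.map (ThetaSetting.modelχq p i j hj).toTheta := by
    refine ⟨(a⁻¹ * (b : C.Huu) * a * (b : C.Huu)⁻¹ : C.Huu), SetLike.coe_mem _, ?_⟩
    rw [Subgroup.coe_mul, Subgroup.coe_mul, Subgroup.coe_mul, Subgroup.coe_inv, Subgroup.coe_inv]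
  have h₁ : (ThetaSetting.modelχq p i j hj).toTheta
      (((a : (ThetaSetting.modelχq p i j hj).PiTemp))⁻¹ * ((b : C.Huu) : (ThetaSetting.modelχq p i j hj).PiTemp) *
        (a : (ThetaSetting.modelχq p i j hj).PiTemp) * (((b : C.Huu) : (ThetaSetting.modelχq p i j hj).PiTemp))⁻¹) ∈
      (ThetaSetting.modelχq p i j hj).lDeltaTheta l := by
    rw [← C.map_toTheta_Huu]
    exact Subgroup.mem_inf.mpr ⟨hHuu, hΔ⟩
  exact C.forall_sq_eq_red_comm_of_eq_zpow_neg_two τ hC hS M a ha b hb h₁ _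
    (toTheta_comm_eq_cThetaχq_zpow_neg_two p i j hj C a ha hdeg b hb hyb h₁)
    (exists_zpow_red_cThetaχq_pow_eq p i j hj τ M)

/-! ## §3 At the Tate model with NO Δ-stability hypothesis: clause (4) suffices (file 3) -/

/-- **(β) AT THE TATE MODEL, UNCONDITIONALLY IN `γ`**: at `modelχq p i j` (`j` even), for EVERY `E`, EVERY `X̲̲`-choice `C`, every tower
and level, and every admissible `γ` of `cor219_iii_of_hearts` — `hγ`, clause (4) `hK`, clause (5) `hL`, `γ̃`/`γ̄_M` compatibilities — the
discrepancy `red_M(F b̂²)·red_M(f b̂²)⁻¹` at any geometric `b̂ ∈ Π^tp_X̲̲` with `b̂² ∈ Π^tp_Ÿ̲̲` is a square: the Δ-stability input is file 3's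
`aug_apply_eq_one_modelχq_of_map_ker_toTheta_eq`. [cite: MochizukiEtTh2009, Cor 2.19 (iii) p.64] -/
theorem isSquare_transport_discrepancy_modelχq
    {E : (ThetaSetting.modelχq p i j hj).EtaleThetaData} {l : ℕ} (C : E.DoubleUnderline l) {Es : Set ℕ+}
    (τ : (ThetaSetting.modelχq p i j hj).CyclotomeTower l Es)
    (hC : (ThetaSetting.modelχq p i j hj).Compat) (hS : (ThetaSetting.modelχq p i j hj).Sec2Hyps)
    (h15 : ThetaSetting.Prop15iii E hC)
    (γ : (C.thetaEnvTower τ hC hS).PiX ≃ₜ* (C.thetaEnvTower τ hC hS).PiX)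
    (hγ : (C.thetaEnvTower τ hC hS).PiYdd.map γ.toMulEquiv.toMonoidHom = (C.thetaEnvTower τ hC hS).PiYdd)
    (hK : ((ThetaSetting.modelχq p i j hj).toTheta.comp C.Huu.subtype).ker.map γ.toMulEquiv.toMonoidHom =
      ((ThetaSetting.modelχq p i j hj).toTheta.comp C.Huu.subtype).ker)
    (hL : (C.thetaEnvTower τ hC hS).lDeltaTheta.map γ.toMulEquiv.toMonoidHom = (C.thetaEnvTower τ hC hS).lDeltaTheta)
    (γΛ : (ThetaSetting.modelχq p i j hj).lDeltaTheta l ≃* (ThetaSetting.modelχq p i j hj).lDeltaTheta l)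
    (hγΛ : ∀ (g : (C.thetaEnvTower τ hC hS).lDeltaTheta) (hg : γ g ∈ (C.thetaEnvTower τ hC hS).lDeltaTheta),
      C.toLDelta ⟨γ g, hg⟩ = γΛ (C.toLDelta g))
    (M : Es) (γμ : (C.thetaEnvTower τ hC hS).mu M ≃* (C.thetaEnvTower τ hC hS).mu M)
    (hγμ : ∀ (g : (C.thetaEnvTower τ hC hS).lDeltaTheta) (hg : γ g ∈ (C.thetaEnvTower τ hC hS).lDeltaTheta),
      (C.thetaEnvTower τ hC hS).thetaMod M ⟨γ g, hg⟩ = γμ ((C.thetaEnvTower τ hC hS).thetaMod M g))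
    {f : contCocycles (ThetaSetting.modelχq p i j hj).toTheta (ThetaSetting.modelχq p i j hj).DeltaTheta C.GtpYdduu}
    (hf : f ∈ C.rootCocycles hC)
    (F : C.GtpYdduu → (ThetaSetting.modelχq p i j hj).lDeltaTheta l)
    (hF : ∀ g : (C.thetaEnvTower τ hC hS).PiYdd,
      F (C.inclYdduu g) = γΛ.symm ⟨(f.1 (C.inclYdduu ⟨γ g, C.apply_mem_PiYdd τ hC hS γ hγ g⟩) :
        (ThetaSetting.modelχq p i j hj).GtpTheta), hf.1 _⟩)
    (bh : C.Huu) (hbh : (ThetaSetting.modelχq p i j hj).aug.toMonoidHom (bh : (ThetaSetting.modelχq p i j hj).PiTemp) = 1)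
    (hb2 : bh ^ 2 ∈ (C.thetaEnvTower τ hC hS).PiYdd) :
    IsSquare ((τ.mod M).red (F (C.inclYdduu ⟨bh ^ 2, hb2⟩)) *
      ((τ.mod M).red ⟨(f.1 (C.inclYdduu ⟨bh ^ 2, hb2⟩) : (ThetaSetting.modelχq p i j hj).GtpTheta), hf.1 _⟩)⁻¹) :=
  C.isSquare_transport_discrepancy_of_aug_apply_eq_one τ hC hS h15 (ThetaSetting.modelχq_isEtThOrigin p i j hj) γ hγ hL γΛ
    hγΛ M γμ hγμ hf F hF bh hbh hb2 (aug_apply_eq_one_modelχq_of_map_ker_toTheta_eq p i j hj C γ hK bh hbh)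

/-- **RESIDUE FORM AT THE TATE MODEL for EVERY admissible `γ`** (the (PH)-input of abc-iut-L1-t6's (3m) knit and of abc-iut-f-142's
`forall_exists_exponent_value_of_residue`, p493861): at `modelχq p i j` (`j` even), every `E`, every `X̲̲`-choice `C`, every tower
and level `M`, every admissible `γ` (`hγ`, clause (4) `hK`, clause (5) `hL`, `γ̃`/`γ̄_M`), every root cocycle `f` with transport `F`
(clause (a) `hF`), every geometric `ã` of degree `l` and geometric `b̂` with `b̂² ∈ Π^tp_Ÿ̲̲`, `ŷ(b̂²) = ι(1)²`:
`∃ m, red_M θ⁅(ã^m)⁻¹, b̂²⁆ = red_M(F b̂²) · red_M(f b̂²)⁻¹` — file 1's socket form with `hsq` (§2) and Δ-stability (file 3) discharged.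
[cite: MochizukiEtTh2009, Cor 2.19 (iii) p.64] -/
theorem exists_zpow_red_comm_eq_discrepancy_modelχq
    {E : (ThetaSetting.modelχq p i j hj).EtaleThetaData} {l : ℕ} (C : E.DoubleUnderline l) {Es : Set ℕ+}
    (τ : (ThetaSetting.modelχq p i j hj).CyclotomeTower l Es)
    (hC : (ThetaSetting.modelχq p i j hj).Compat) (hS : (ThetaSetting.modelχq p i j hj).Sec2Hyps)
    (h15 : ThetaSetting.Prop15iii E hC)
    (γ : (C.thetaEnvTower τ hC hS).PiX ≃ₜ* (C.thetaEnvTower τ hC hS).PiX)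
    (hγ : (C.thetaEnvTower τ hC hS).PiYdd.map γ.toMulEquiv.toMonoidHom = (C.thetaEnvTower τ hC hS).PiYdd)
    (hK : ((ThetaSetting.modelχq p i j hj).toTheta.comp C.Huu.subtype).ker.map γ.toMulEquiv.toMonoidHom =
      ((ThetaSetting.modelχq p i j hj).toTheta.comp C.Huu.subtype).ker)
    (hL : (C.thetaEnvTower τ hC hS).lDeltaTheta.map γ.toMulEquiv.toMonoidHom = (C.thetaEnvTower τ hC hS).lDeltaTheta)
    (γΛ : (ThetaSetting.modelχq p i j hj).lDeltaTheta l ≃* (ThetaSetting.modelχq p i j hj).lDeltaTheta l)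
    (hγΛ : ∀ (g : (C.thetaEnvTower τ hC hS).lDeltaTheta) (hg : γ g ∈ (C.thetaEnvTower τ hC hS).lDeltaTheta),
      C.toLDelta ⟨γ g, hg⟩ = γΛ (C.toLDelta g))
    (M : Es) (γμ : (C.thetaEnvTower τ hC hS).mu M ≃* (C.thetaEnvTower τ hC hS).mu M)
    (hγμ : ∀ (g : (C.thetaEnvTower τ hC hS).lDeltaTheta) (hg : γ g ∈ (C.thetaEnvTower τ hC hS).lDeltaTheta),
      (C.thetaEnvTower τ hC hS).thetaMod M ⟨γ g, hg⟩ = γμ ((C.thetaEnvTower τ hC hS).thetaMod M g))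
    {f : contCocycles (ThetaSetting.modelχq p i j hj).toTheta (ThetaSetting.modelχq p i j hj).DeltaTheta C.GtpYdduu}
    (hf : f ∈ C.rootCocycles hC)
    (F : C.GtpYdduu → (ThetaSetting.modelχq p i j hj).lDeltaTheta l)
    (hF : ∀ g : (C.thetaEnvTower τ hC hS).PiYdd,
      F (C.inclYdduu g) = γΛ.symm ⟨(f.1 (C.inclYdduu ⟨γ g, C.apply_mem_PiYdd τ hC hS γ hγ g⟩) :
        (ThetaSetting.modelχq p i j hj).GtpTheta), hf.1 _⟩)
    (a : C.Huu) (ha : (ThetaSetting.modelχq p i j hj).aug.toMonoidHom (a : (ThetaSetting.modelχq p i j hj).PiTemp) = 1)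
    (hdeg : Multiplicative.toAdd (gfpSnd (a : PiTpχq p i j).left) = (l : ℤ))
    (bh : C.Huu) (hbh : (ThetaSetting.modelχq p i j hj).aug.toMonoidHom (bh : (ThetaSetting.modelχq p i j hj).PiTemp) = 1)
    (hb2 : bh ^ 2 ∈ (C.thetaEnvTower τ hC hS).PiYdd)
    (hyb : yCoordχq p i j (((bh ^ 2 : C.Huu)) : PiTpχq p i j) = (iotaZ (Multiplicative.ofAdd 1)) ^ 2) :
    ∃ (m : ℤ) (hm : (ThetaSetting.modelχq p i j hj).toTheta
        ((((a ^ m : C.Huu) : (ThetaSetting.modelχq p i j hj).PiTemp))⁻¹ *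
          ((((⟨bh ^ 2, hb2⟩ : (C.thetaEnvTower τ hC hS).PiYdd) : C.Huu)) : (ThetaSetting.modelχq p i j hj).PiTemp) *
          ((a ^ m : C.Huu) : (ThetaSetting.modelχq p i j hj).PiTemp) *
          (((((⟨bh ^ 2, hb2⟩ : (C.thetaEnvTower τ hC hS).PiYdd) : C.Huu)) : (ThetaSetting.modelχq p i j hj).PiTemp))⁻¹) ∈
        (ThetaSetting.modelχq p i j hj).lDeltaTheta l),
      (τ.mod M).red ⟨_, hm⟩ = (τ.mod M).red (F (C.inclYdduu ⟨bh ^ 2, hb2⟩)) *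
        ((τ.mod M).red ⟨(f.1 (C.inclYdduu ⟨bh ^ 2, hb2⟩) : (ThetaSetting.modelχq p i j hj).GtpTheta), hf.1 _⟩)⁻¹ := by
  have hb : (ThetaSetting.modelχq p i j hj).aug.toMonoidHom
      ((((⟨bh ^ 2, hb2⟩ : (C.thetaEnvTower τ hC hS).PiYdd) : C.Huu)) : (ThetaSetting.modelχq p i j hj).PiTemp) = 1 := by
    change (ThetaSetting.modelχq p i j hj).aug.toMonoidHom (((bh ^ 2 : C.Huu)) : (ThetaSetting.modelχq p i j hj).PiTemp) = 1
    rw [Subgroup.coe_pow, map_pow, hbh, one_pow]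
  exact C.exists_zpow_red_comm_eq_discrepancy_of_aug_apply_eq_one τ hC hS h15 (ThetaSetting.modelχq_isEtThOrigin p i j hj) γ hγ hL
    γΛ hγΛ M γμ hγμ hf F hF bh hbh hb2 (aug_apply_eq_one_modelχq_of_map_ker_toTheta_eq p i j hj C γ hK bh hbh) a
    (forall_sq_eq_red_comm_modelχq p i j hj C τ hC hS M a ha hdeg ⟨bh ^ 2, hb2⟩ hb hyb)

/-- **The level-`M` Δ_P-HEART AT THE TATE MODEL for EVERY admissible `γ`, EVERY level** (`j` even; every `E`, every `X̲̲`-choice `C`):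
`heart_modelχq_of_aug_apply_eq_one` with the Δ-stability input supplied by file 3.  Inputs beyond `cor219_iii_of_hearts`' own
binders: `Compat`/`Sec2Hyps`/Prop. 1.5 (iii) of the datum, abc-iut-f-142's transport clauses (b) `hFmul` (c) `hFc`, a geometric
`ã` of degree `l`, a geometric `b̂` with `b̂² ∈ Π^tp_Ÿ̲̲`, `ŷ(b̂²) = ι(1)²`, and abc-iut-L1-t6's (D1*) uniqueness `huniq` at `b̂²`.
[cite: MochizukiEtTh2009, Cor 2.19 (iii) p.65] -/
theorem heart_modelχq
    {E : (ThetaSetting.modelχq p i j hj).EtaleThetaData} {l : ℕ} (C : E.DoubleUnderline l) {Es : Set ℕ+}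
    (τ : (ThetaSetting.modelχq p i j hj).CyclotomeTower l Es)
    (hC : (ThetaSetting.modelχq p i j hj).Compat) (hS : (ThetaSetting.modelχq p i j hj).Sec2Hyps)
    (h15 : ThetaSetting.Prop15iii E hC)
    (γ : (C.thetaEnvTower τ hC hS).PiX ≃ₜ* (C.thetaEnvTower τ hC hS).PiX)
    (hγ : (C.thetaEnvTower τ hC hS).PiYdd.map γ.toMulEquiv.toMonoidHom = (C.thetaEnvTower τ hC hS).PiYdd)
    (hK : ((ThetaSetting.modelχq p i j hj).toTheta.comp C.Huu.subtype).ker.map γ.toMulEquiv.toMonoidHom =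
      ((ThetaSetting.modelχq p i j hj).toTheta.comp C.Huu.subtype).ker)
    (hL : (C.thetaEnvTower τ hC hS).lDeltaTheta.map γ.toMulEquiv.toMonoidHom = (C.thetaEnvTower τ hC hS).lDeltaTheta)
    (γΛ : (ThetaSetting.modelχq p i j hj).lDeltaTheta l ≃* (ThetaSetting.modelχq p i j hj).lDeltaTheta l)
    (hγΛ : ∀ (g : (C.thetaEnvTower τ hC hS).lDeltaTheta) (hg : γ g ∈ (C.thetaEnvTower τ hC hS).lDeltaTheta),
      C.toLDelta ⟨γ g, hg⟩ = γΛ (C.toLDelta g))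
    (M : Es) (γμ : (C.thetaEnvTower τ hC hS).mu M ≃* (C.thetaEnvTower τ hC hS).mu M)
    (hγμ : ∀ (g : (C.thetaEnvTower τ hC hS).lDeltaTheta) (hg : γ g ∈ (C.thetaEnvTower τ hC hS).lDeltaTheta),
      (C.thetaEnvTower τ hC hS).thetaMod M ⟨γ g, hg⟩ = γμ ((C.thetaEnvTower τ hC hS).thetaMod M g))
    {f : contCocycles (ThetaSetting.modelχq p i j hj).toTheta (ThetaSetting.modelχq p i j hj).DeltaTheta C.GtpYdduu}
    (hf : f ∈ C.rootCocycles hC)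
    (F : C.GtpYdduu → (ThetaSetting.modelχq p i j hj).lDeltaTheta l)
    (hF : ∀ g : (C.thetaEnvTower τ hC hS).PiYdd,
      F (C.inclYdduu g) = γΛ.symm ⟨(f.1 (C.inclYdduu ⟨γ g, C.apply_mem_PiYdd τ hC hS γ hγ g⟩) :
        (ThetaSetting.modelχq p i j hj).GtpTheta), hf.1 _⟩)
    (hFmul : ∀ g h : C.GtpYdduu, (F (g * h) : (ThetaSetting.modelχq p i j hj).GtpTheta) =
      (F g : (ThetaSetting.modelχq p i j hj).GtpTheta) * ((ThetaSetting.modelχq p i j hj).toTheta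
        (g : (ThetaSetting.modelχq p i j hj).PiTemp) * (F h : (ThetaSetting.modelχq p i j hj).GtpTheta) *
        ((ThetaSetting.modelχq p i j hj).toTheta (g : (ThetaSetting.modelχq p i j hj).PiTemp))⁻¹))
    (hFc : (C.thetaEnvTower τ hC hS).pullbackCocycle M γ hγ γμ (C.modN (τ.mod M) f hf.1) =
      fun g => (τ.mod M).red (F (C.inclYdduu g)))
    (a : C.Huu) (ha : (ThetaSetting.modelχq p i j hj).aug.toMonoidHom (a : (ThetaSetting.modelχq p i j hj).PiTemp) = 1)
    (hdeg : Multiplicative.toAdd (gfpSnd (a : PiTpχq p i j).left) = (l : ℤ))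
    (bh : C.Huu) (hbh : (ThetaSetting.modelχq p i j hj).aug.toMonoidHom (bh : (ThetaSetting.modelχq p i j hj).PiTemp) = 1)
    (hb2 : bh ^ 2 ∈ (C.thetaEnvTower τ hC hS).PiYdd)
    (hyb : yCoordχq p i j (((bh ^ 2 : C.Huu)) : PiTpχq p i j) = (iotaZ (Multiplicative.ofAdd 1)) ^ 2)
    (huniq : ∀ φ ψ : (C.thetaEnvTower τ hC hS).PiYdd → MuN p M, IsLocallyConstant φ → IsLocallyConstant ψ →
      (∀ g h : (C.thetaEnvTower τ hC hS).PiYdd,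
        (ThetaSetting.modelχq p i j hj).aug.toMonoidHom ((g : C.Huu) : (ThetaSetting.modelχq p i j hj).PiTemp) = 1 →
        (ThetaSetting.modelχq p i j hj).aug.toMonoidHom ((h : C.Huu) : (ThetaSetting.modelχq p i j hj).PiTemp) = 1 →
        φ (g * h) = φ g * φ h) →
      (∀ g h : (C.thetaEnvTower τ hC hS).PiYdd,
        (ThetaSetting.modelχq p i j hj).aug.toMonoidHom ((g : C.Huu) : (ThetaSetting.modelχq p i j hj).PiTemp) = 1 →
        (ThetaSetting.modelχq p i j hj).aug.toMonoidHom ((h : C.Huu) : (ThetaSetting.modelχq p i j hj).PiTemp) = 1 →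
        ψ (g * h) = ψ g * ψ h) →
      (∀ g : (C.thetaEnvTower τ hC hS).PiYdd,
        (ThetaSetting.modelχq p i j hj).aug.toMonoidHom ((g : C.Huu) : (ThetaSetting.modelχq p i j hj).PiTemp) = 1 →
        (ThetaSetting.modelχq p i j hj).toTheta ((g : C.Huu) : (ThetaSetting.modelχq p i j hj).PiTemp) ∈
          (ThetaSetting.modelχq p i j hj).DeltaTheta → φ g = ψ g) →
      φ ⟨bh ^ 2, hb2⟩ = ψ ⟨bh ^ 2, hb2⟩ →
      ∀ g : (C.thetaEnvTower τ hC hS).PiYdd,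
        (ThetaSetting.modelχq p i j hj).aug.toMonoidHom ((g : C.Huu) : (ThetaSetting.modelχq p i j hj).PiTemp) = 1 →
        φ g = ψ g) :
    ∃ m : ℤ, ∀ g : (C.thetaEnvTower τ hC hS).PiYdd,
      (ThetaSetting.modelχq p i j hj).aug.toMonoidHom ((g : C.Huu) : (ThetaSetting.modelχq p i j hj).PiTemp) = 1 →
      (τ.mod M).red (F (C.inclYdduu g)) =
        (τ.mod M).red ⟨(C.conjRoot hC (a ^ m) f.1 (C.inclYdduu g) : (ThetaSetting.modelχq p i j hj).GtpTheta),
          ((ThetaSetting.modelχq p i j hj).lDeltaTheta_normal l).conj_mem _ (hf.1 _) _⟩ :=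
  have hb : (ThetaSetting.modelχq p i j hj).aug.toMonoidHom
      ((((⟨bh ^ 2, hb2⟩ : (C.thetaEnvTower τ hC hS).PiYdd) : C.Huu)) : (ThetaSetting.modelχq p i j hj).PiTemp) = 1 := by
    change (ThetaSetting.modelχq p i j hj).aug.toMonoidHom (((bh ^ 2 : C.Huu)) : (ThetaSetting.modelχq p i j hj).PiTemp) = 1
    rw [Subgroup.coe_pow, map_pow, hbh, one_pow]
  C.heart_of_isSquare_of_aug_apply_eq_one τ hC hS h15 (ThetaSetting.modelχq_isEtThOrigin p i j hj) γ hγ hL γΛ hγΛ M γμ hγμ hf F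
    hF hFmul hFc a ha bh hbh hb2 (aug_apply_eq_one_modelχq_of_map_ker_toTheta_eq p i j hj C γ hK bh hbh) huniq
    (forall_sq_eq_red_comm_modelχq p i j hj C τ hC hS M a ha hdeg ⟨bh ^ 2, hb2⟩ hb hyb)

end SettingModel

end Literature.AnabelianGeometry.EtaleTheta

end
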